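import Summits.KontsevichZagierPeriods.KontsevichZagierPeriods.Theorems.HoffmanRelationInKZ.Negative.HoffmanElement

/-!
# Crux `HoffmanRelationInKZ` (stmt-KontsevichZagierPeriods-3930): the coefficient-sum invariant — additivity is needed

Landed copy of §3a of `Cruxes/HoffmanRelationInKZ/Disproof.lean` (crux disprover). The coefficient sum
`coeffSum [r] = 1` kills every change-of-variables and every Newton–Leibniz generator (shape
`[r] − [r']`) but not additivity (`[r] − [r₁] − [r₂]`); on Hoffman's element
`coeffSum (H_Z(s)) = 2k − w` (`coeffSum_hoffmanElement`). Hence **unless `w = 2k` any move-proof of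
Hoffman(s) uses an additivity move** (`not_mem_covNL`) — all odd weights (`not_mem_covNL_of_odd`), and
the first live instance `s = (3)` (`three_not_mem_covNL`). For `w = 2k` see `DualitySymmetry.lean`
(self-dual indices ARE change-of-variables-only instances).

Reference: M. Kontsevich, D. Zagier, *Periods* (2001), §1.2 (the three rules).
-/

noncomputable section

namespace Summit.KontsevichZagierPeriods.HoffmanRelationInKZ.Negative

open MeasureTheory Set
open Literature.NumberTheory.Transcendental
open Literature.NumberTheory.Transcendental.KZ
open Summit.KontsevichZagierPeriods.KontsevichZagierPeriods.Theses.FurushoPentagon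

/-! ## The coefficient-sum invariant -/

/-- The coefficient-sum invariant `ε [r] = 1`. -/
def coeffSum : FormalRep →+ ℤ := FreeAbelianGroup.lift fun _ => (1 : ℤ)

/-- `ε [r] = 1`. [folklore] -/
@[simp] theorem coeffSum_of {n : ℕ} (r : IntegralRep n) : coeffSum (of r) = 1 :=
  FreeAbelianGroup.lift_apply_of _ _

/-- The sub-calculus generated by changes of variables and Newton–Leibniz moves only. -/
def covNL : AddSubgroup FormalRep := AddSubgroup.closure (changeOfVariablesRel ∪ newtonLeibnizRel)

/-- `covNL ≤ relations`. [folklore] -/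
theorem covNL_le_relations : covNL ≤ relations :=
  AddSubgroup.closure_mono (by
    rintro c (hc | hc)
    · exact Or.inl (Or.inr hc)
    · exact Or.inr hc)

/-- **`ε` kills `covNL`.** [folklore] -/
theorem covNL_le_ker_coeffSum : covNL ≤ coeffSum.ker := by
  refine (AddSubgroup.closure_le _).mpr ?_
  rintro c (hc | hc)
  · obtain ⟨n, r, r', Φ, Φ', -, -, -, -, -, rfl⟩ := hc
    simp
  · obtain ⟨n, r, r', a, b, F, -, -, -, -, -, -, -, -, rfl⟩ := hc
    simp

/-- `ε` of a pinned value at an admissible index is `1`. -/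
theorem coeffSum_pinned {Z : List ℕ → FormalRep} (hZ : Pinned Z) {u : List ℕ} (hu : MZV.IsAdmissible u) :
    coeffSum (Z u) = 1 := by
  rw [hZ u hu, coeffSum_of]

/-- `Σ_{i < k} s_i = Σ s` in the `List.range/getD` indexing. [folklore] -/
theorem list_sum_range_getD (s : List ℕ) :
    ((List.range s.length).map fun i => s.getD i 0).sum = s.sum := by
  rw [list_sum_range_map_fin]
  simp_rw [getD_fin, List.get_eq_getElem]
  exact Fin.sum_univ_getElem s

/-- **`ε(H_Z(s)) = 2k − w`**: `k` raised terms minus `Σ_i (s_i − 1) = w − k` split terms. -/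
theorem coeffSum_hoffmanElement {Z : List ℕ → FormalRep} (hZ : Pinned Z) {s : List ℕ}
    (hs : MZV.IsAdmissible s) :
    coeffSum (hoffmanElement Z s) = 2 * (s.length : ℤ) - (MZV.weight s : ℤ) := by
  rw [hoffmanElement_eq, map_sub, map_list_sum, map_list_sum, List.map_map, List.map_map]
  have h1 : ∀ i ∈ List.range s.length, (coeffSum ∘ fun i => Z (raise s i)) i = 1 := fun i hi =>
    coeffSum_pinned hZ (isAdmissible_raise hs (List.mem_range.mp hi))
  have h2 : ∀ i ∈ List.range s.length,
      (coeffSum ∘ fun i => ((List.range (s.getD i 0 - 1)).map fun j => Z (split s i j)).sum) i =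
        ((s.getD i 0 - 1 : ℕ) : ℤ) := by
    intro i hi
    rw [Function.comp_apply, map_list_sum, List.map_map]
    have h3 : ∀ j ∈ List.range (s.getD i 0 - 1), (coeffSum ∘ fun j => Z (split s i j)) j = 1 :=
      fun j hj => coeffSum_pinned hZ (isAdmissible_split hs (List.mem_range.mp hi) (List.mem_range.mp hj))
    rw [List.map_congr_left h3]
    simp
  rw [List.map_congr_left h1, List.map_congr_left h2, list_sum_range_map_fin, list_sum_range_map_fin]
  have h4 : ∀ i : Fin s.length, ((s.getD i 0 - 1 : ℕ) : ℤ) = (s.getD i 0 : ℤ) - 1 := by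
    intro i
    have : 1 ≤ s.getD i 0 := by
      rw [getD_eq_getElem i.2]; exact one_le_getElem_of_isAdmissible hs i.2
    omega
  have h5 : ∑ i : Fin s.length, (s.getD i 0 : ℤ) = (MZV.weight s : ℤ) := by
    rw [← Nat.cast_sum, MZV.weight, ← list_sum_range_getD s, list_sum_range_map_fin]
  simp only [h4, Finset.sum_sub_distrib, h5, Finset.sum_const, Finset.card_univ, Fintype.card_fin]
  ring

/-- **Additivity is load-bearing for every `s` with `w ≠ 2k`**: then `H_Z(s)` is not in the
sub-calculus of changes of variables and Newton–Leibniz moves. (For `w = 2k` see §5: the self-dual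
indices, where `H(s)` IS a sum of single changes of variables.) [folklore] -/
theorem not_mem_covNL {Z : List ℕ → FormalRep} (hZ : Pinned Z) {s : List ℕ} (hs : MZV.IsAdmissible s)
    (hw : MZV.weight s ≠ 2 * s.length) : hoffmanElement Z s ∉ covNL := by
  intro h
  have h0 : coeffSum (hoffmanElement Z s) = 0 := covNL_le_ker_coeffSum h
  rw [coeffSum_hoffmanElement hZ hs] at h0
  omega

/-- The first live instance `s = (3)` (`ζ(4) = ζ(3,1) + ζ(2,2)`): `ε = −1`, additivity is needed. -/
theorem three_not_mem_covNL {Z : List ℕ → FormalRep} (hZ : Pinned Z) : hoffmanElement Z [3] ∉ covNL :=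
  not_mem_covNL hZ (by decide) (by decide)

/-- Every odd-weight instance needs additivity. -/
theorem not_mem_covNL_of_odd {Z : List ℕ → FormalRep} (hZ : Pinned Z) {s : List ℕ}
    (hs : MZV.IsAdmissible s) (hw : Odd (MZV.weight s)) : hoffmanElement Z s ∉ covNL :=
  not_mem_covNL hZ hs fun h => by rw [h] at hw; exact (Nat.not_odd_iff_even.mpr (even_two_mul _)) hw



end Summit.KontsevichZagierPeriods.HoffmanRelationInKZ.Negative
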